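import Literature.NumberTheory.Sieve.BombieriFriedlanderIwaniecDyadicFromDI11
import HarnessLib

/-!
# Deshouillers–Iwaniec's Theorem 11 at `s = 1` as the one remaining named input of the BFI cone

Topic `Literature/NumberTheory/Sieve`. Decomposition file (librarian, fact-decompose,
2026-08-16) for the named fact `twinSieve_bfi` (`HardyLittlewood.lean`; the twin-prime sieve
upper bound with constant `7/2 = 4 · (7/8)` from the level of distribution `4/7` of E. Bombieri,
J. B. Friedlander, H. Iwaniec, *Primes in arithmetic progressions to large moduli*, Acta Math. 156
(1986), Theorem 10), which a prove seat triaged XL and parked on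
`BombieriFriedlanderIwaniecTheorem10Pi`.

The tree has since reduced the ENTIRE BFI cone — Theorem 10 (`BombieriFriedlanderIwaniecTheorem10`),
its `π`-form (`…Theorem10Pi`) and dyadic form (`BFI.Theorem10Dyadic`), Theorems 1, 2, 5, 5*
(`…Theorem1`, `…Theorem2`, `…Theorem5`, `…Theorem5Star`, `…Theorem5StarInterval`), the level of
distribution `bfi_wellFactorable_level` and `twinSieve_bfi` — to ONE hypothesis, written out
verbatim as the section variable `h11` of `BombieriFriedlanderIwaniecLemma1OffdiagFromDI11.lean` /
`…DyadicFromDI11.lean`: Deshouillers–Iwaniec's Theorem 11 (Invent. Math. 70 (1982), §1.4 p. 236) at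
`s = 1` for the dilations of a smooth weight `g₀` supported in `[1, 2] × (0, ∞)` (the tree's
parametrised predicate `BFI.L1.DI11For g₀`). This file names that hypothesis as a closed fact and
records the one-line assemblies; the decomposition has exactly ONE child (no other unproved input
exists), and the child (a bound for trilinear forms in Kloosterman sums `S(m r̄, ±n; c)`) is not
a restatement of the parent (a sieve bound for twin primes) nor of any fact it discharges.

## Child (named fact introduced here)

* `DeshouillersIwaniec1982_theorem11_unit` — DI 1982, Theorem 11 at `s = 1`, dilation weights.

## Main results (all proved, one line each over the accepted `…_of_di11` theorems)

* `twinSieve_bfi_holds_of : child → twinSieve_bfi`;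
* `BombieriFriedlanderIwaniecTheorem10Pi_holds_of`, `BombieriFriedlanderIwaniecTheorem10_holds_of`,
  `BFI.Theorem10Dyadic_holds_of`, `BombieriFriedlanderIwaniecTheorem1_holds_of`,
  `BombieriFriedlanderIwaniecTheorem2_holds_of`, `BombieriFriedlanderIwaniecTheorem5_holds_of`,
  `BombieriFriedlanderIwaniecTheorem5Star_holds_of`,
  `BombieriFriedlanderIwaniecTheorem5StarInterval_holds_of`, `bfi_wellFactorable_level_holds_of_theorem11`
  (the name `bfi_wellFactorable_level_holds_of` is the four-leaf record of
  `LevelOfDistributionBFILeaves.lean`, whose four leaves BFI Thms. 1, 2, 5* are discharged here from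
  the same child; Thm. 0 (b) is not needed on this route).

## Mathlib / tree search

Tree (all used): `twinSieve_bfi_of_di11`, `BombieriFriedlanderIwaniecTheorem{1,5,10}_of_di11`,
`bfi_wellFactorable_level_of_di11` (`…Lemma1OffdiagFromDI11`), `…Theorem{2,5Star,5StarInterval,10Pi}_of_di11`,
`BFI.Theorem10Dyadic_of_di11` (`…DyadicFromDI11`). `lean search 'DI11For'`: only the parametrised
predicate and its consumers; no closed named fact for Theorem 11 (2026-08-16). The further
reductions of Theorem 11 to Kuznetsov's formula and the large sieve inequalities in progress in
`…Lemma1DI11FromKuznetsovBound`, `…KuznetsovBoundFromSpectral`, `DeshouillersIwaniec*.lean` consume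
the same predicate and will discharge the child.

## References

* J.-M. Deshouillers, H. Iwaniec, *Kloosterman sums and Fourier coefficients of cusp forms*,
  Invent. Math. 70 (1982), 219–288: §1.4 (1.53)–(1.56), Theorem 10, Theorem 11 (p. 236).
  [DeshouillersIwaniec1982]
* S. Drappeau, *Sums of Kloosterman sums in arithmetic progressions, and the error term in the
  dispersion method*, Proc. LMS 114 (2017), Prop. 4.13 (`q = 1`). [Drappeau2017]
* E. Bombieri, J. B. Friedlander, H. Iwaniec, Acta Math. 156 (1986), 203–251: Theorem 10 (p. 209),
  §8 Theorem 1, §9 Theorem 2, §12 Theorem 5, §13 Theorem 5*. [BombieriFriedlanderIwaniecActa1986]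
-/

noncomputable section

open scoped ContDiff

namespace Literature.NumberTheory.Sieve

/-- NAMED FACT — **Deshouillers–Iwaniec 1982, Theorem 11 at `s = 1`, for dilation weights**
(Invent. Math. 70, §1.4 p. 236: for `g` as in (1.53) supported in `[C, 2C] × …`, complex `b_{nr}`
and `a_m` the characteristic function of an interval,
`∑_{r∼R} ∑_{n≤N} b_{nr} ∑_m a_m ∑_{(c,r)=1} g(c, m) S(m r̄, ±n; c) ≪_ε (CMNR)^ε L(C, M, N, R, S) M^{1/2} ‖b‖`
with `L` of (1.56); Drappeau, Proc. LMS 114 (2017), Prop. 4.13 for `q = 1`), in the tree's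
rendering `BFI.L1.DI11For g₀` (`…Lemma1OffdiagFromDI11`: the sums `diSum`, the quantity `diL` at
`S = 1/2`, so that `S < s ≤ 2S` means `s = 1`) for EVERY smooth weight `g₀ : ℝ² → ℝ` with compact
support contained in `[1, 2] × (0, ∞)`, dilated to `g(c, m) = g₀(c/C, m/M)`. The printed proof is
Kuznetsov's formula for `Γ₀(rs)` with the large sieve inequalities for Fourier coefficients of
holomorphic and Maass cusp forms and Eisenstein series (Theorems 1, 2, 5–9 of the source, §9.1).
Users take `(h : DeshouillersIwaniec1982_theorem11_unit)`.
[cite: DeshouillersIwaniec1982, §1.4 Theorem 11 (p. 236) with (1.53)–(1.56)]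
[cite: Drappeau2017, Prop. 4.13] -/
def DeshouillersIwaniec1982_theorem11_unit : Prop :=
  ∀ g₀ : ℝ × ℝ → ℝ, ContDiff ℝ ∞ g₀ → HasCompactSupport g₀ →
    tsupport g₀ ⊆ Set.Icc (1 : ℝ) 2 ×ˢ Set.Ioi (0 : ℝ) → BFI.L1.DI11For g₀

/-- **The twin-prime sieve bound `twinSieve_bfi` from Deshouillers–Iwaniec's Theorem 11 at
`s = 1`** (`twinSieve_bfi_of_di11`). [cite: BombieriFriedlanderIwaniecActa1986, Theorem 10 (p. 209)]
[cite: DeshouillersIwaniec1982, §1.4 Theorem 11 (p. 236)] -/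
theorem twinSieve_bfi_holds_of (h : DeshouillersIwaniec1982_theorem11_unit) : twinSieve_bfi :=
  twinSieve_bfi_of_di11 h

/-- **Maynard's `π`-form of BFI Theorem 10 from DI Theorem 11 at `s = 1`**
(`BombieriFriedlanderIwaniecTheorem10Pi_of_di11`). [cite: BombieriFriedlanderIwaniecActa1986, Theorem 10 (p. 209)] -/
theorem BombieriFriedlanderIwaniecTheorem10Pi_holds_of (h : DeshouillersIwaniec1982_theorem11_unit) :
    BombieriFriedlanderIwaniecTheorem10Pi :=
  BombieriFriedlanderIwaniecTheorem10Pi_of_di11 h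

/-- **BFI Theorem 10 from DI Theorem 11 at `s = 1`** (`BombieriFriedlanderIwaniecTheorem10_of_di11`).
[cite: BombieriFriedlanderIwaniecActa1986, Theorem 10 (p. 209)] -/
theorem BombieriFriedlanderIwaniecTheorem10_holds_of (h : DeshouillersIwaniec1982_theorem11_unit) :
    BombieriFriedlanderIwaniecTheorem10 :=
  BombieriFriedlanderIwaniecTheorem10_of_di11 h

/-- **The dyadic Theorem 10 from DI Theorem 11 at `s = 1`** (`BFI_Theorem10Dyadic_of_di11`).
[cite: BombieriFriedlanderIwaniecActa1986, Theorem 10 (p. 209) and §15] -/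
theorem BFI.Theorem10Dyadic_holds_of (h : DeshouillersIwaniec1982_theorem11_unit) :
    BFI.Theorem10Dyadic :=
  BFI_Theorem10Dyadic_of_di11 h

/-- **BFI Theorem 1 (§8) from DI Theorem 11 at `s = 1`** (`BombieriFriedlanderIwaniecTheorem1_of_di11`).
[cite: BombieriFriedlanderIwaniecActa1986, §8 Theorem 1 (p. 225)] -/
theorem BombieriFriedlanderIwaniecTheorem1_holds_of (h : DeshouillersIwaniec1982_theorem11_unit) :
    BombieriFriedlanderIwaniecTheorem1 :=
  BombieriFriedlanderIwaniecTheorem1_of_di11 h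

/-- **BFI Theorem 2 (§9) from DI Theorem 11 at `s = 1`** (`BombieriFriedlanderIwaniecTheorem2_of_di11`).
[cite: BombieriFriedlanderIwaniecActa1986, §9 Theorem 2 (p. 230)] -/
theorem BombieriFriedlanderIwaniecTheorem2_holds_of (h : DeshouillersIwaniec1982_theorem11_unit) :
    BombieriFriedlanderIwaniecTheorem2 :=
  BombieriFriedlanderIwaniecTheorem2_of_di11 h

/-- **BFI Theorem 5 (§12) from DI Theorem 11 at `s = 1`** (`BombieriFriedlanderIwaniecTheorem5_of_di11`).
[cite: BombieriFriedlanderIwaniecActa1986, §12 Theorem 5 (p. 237)] -/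
theorem BombieriFriedlanderIwaniecTheorem5_holds_of (h : DeshouillersIwaniec1982_theorem11_unit) :
    BombieriFriedlanderIwaniecTheorem5 :=
  BombieriFriedlanderIwaniecTheorem5_of_di11 h

/-- **BFI Theorem 5* (§13) from DI Theorem 11 at `s = 1`**
(`BombieriFriedlanderIwaniecTheorem5Star_of_di11`). [cite: BombieriFriedlanderIwaniecActa1986, §13 Theorem 5* (p. 238)] -/
theorem BombieriFriedlanderIwaniecTheorem5Star_holds_of (h : DeshouillersIwaniec1982_theorem11_unit) :
    BombieriFriedlanderIwaniecTheorem5Star :=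
  BombieriFriedlanderIwaniecTheorem5Star_of_di11 h

/-- **BFI Theorem 5* on an interval from DI Theorem 11 at `s = 1`**
(`BombieriFriedlanderIwaniecTheorem5StarInterval_of_di11`). [cite: BombieriFriedlanderIwaniecActa1986, §13 Theorem 5* (p. 238)] -/
theorem BombieriFriedlanderIwaniecTheorem5StarInterval_holds_of
    (h : DeshouillersIwaniec1982_theorem11_unit) : BombieriFriedlanderIwaniecTheorem5StarInterval :=
  BombieriFriedlanderIwaniecTheorem5StarInterval_of_di11 h

/-- **The level of distribution `4/7` for well-factorable weights (`bfi_wellFactorable_level`) from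
DI Theorem 11 at `s = 1`** (`bfi_wellFactorable_level_of_di11`). [cite: BombieriFriedlanderIwaniecActa1986, Theorem 10 (p. 209)] -/
theorem bfi_wellFactorable_level_holds_of_theorem11 (h : DeshouillersIwaniec1982_theorem11_unit) :
    bfi_wellFactorable_level :=
  bfi_wellFactorable_level_of_di11 h

end Literature.NumberTheory.Sieve

end
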